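import Summits.QuantumFields.BalabanUV.T4Continuum.Spine.NE9.DirectPairingCrossoverEffective
import Mathlib.Analysis.SumIntegralComparisons
import Mathlib.Analysis.SpecialFunctions.Integrals.Basic

/-!
# T⁴ programme, spine estimate NE9 — THE KING ROUTE's NODE U6 FULLY EFFECTIVE: the R-branch tail in closed form (integral comparison) and the four slots
# of the continuum-limit error each `≤ ε∕4` at every `K ≥ J + N` — census item C44 (c) of cell `pub-balaban-gaps`, seat ne9 (gen 13)

Cell `pub-balaban-gaps` (YM blitz G2, seat ne9, unit `pub-balaban-gaps-ne9-g13`; record `run/shared/lean/pub/pub-balaban-gaps/ne/NE9.md` §5 row C44).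
Summits-side bookkeeping; sequel of `DirectPairingCrossoverEffective` (C44 (a)).  NO definition; nothing of Bałaban's asserted.

WHY.  C44 (a) bounds the King route's continuum-limit error after `K` steps by `2·vol·(E₁a^{N+1}∕(1−a) + Σ_{i≥N+1}R₁(b₀i)^{−κ₀∕2} + 2β·Σ_{n≤N}Λⁿ + w_K)`
(`abs_genFun_sub_lim_le_window`) and makes the UV cut of the E-branch explicit (`geomTail_le_of_log`); the R-branch's p-series tail was left as a series.  This file
closes it in the printed scalars — `Σ_{i≥N+1} R₁(b₀i)^{−κ₀∕2} ≤ R₁b₀^{−κ₀∕2}·N^{1−κ₀∕2}∕(κ₀∕2 − 1)` by the integral test — and assembles the node-U6 statement with all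
four slots `≤ ε∕4`: `∣genFun Z K t − genFunLim Z t∣ ≤ 2·vol·ε` for every `K ≥ J + N`, where `N` is any cut passing the two printed-scalar tests (E: `log`, R: a power)
and `J` is the IR scale from which the profile is `≤ η` with `2η·Σ_{n≤N}Λⁿ ≤ ε∕4` — the E-side's ONE non-printed datum — and `w_K ≤ ε∕4` (NE7b ∕ U5c's term).
* §1 `sum_range_rpow_neg_shift_le` ∕ `tsum_rpow_neg_shift_le`: `Σ_{i≥0} (i+N+1)^{−s} ≤ N^{1−s}∕(s−1)` for `s > 1`, `N ≥ 1` (Mathlib `AntitoneOn.sum_le_integral`,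
  `integral_rpow`, `Real.tsum_le_of_sum_range_le`).
* §2 `crossoverR_tail_le`: the R-branch tail `≤ R₁·b₀^{−κ₀∕2}·N^{1−κ₀∕2}∕(κ₀∕2 − 1)`; `crossoverR_tail_le_of_pow`: `≤ δ` as soon as `R₁b₀^{−κ₀∕2} ≤ (κ₀∕2 − 1)·δ·N^{κ₀∕2−1}`.
* §3 `abs_genFun_sub_lim_le_of_scales`: THE NODE-U6 `K(ε)` — under the hypotheses of `DirectPairingCrossoverEffective.abs_genFun_sub_lim_le_window`, if the cut `N ≥ 1`
  passes `E₁a^{N+1}∕(1−a) ≤ ε∕4` and `R₁b₀^{−κ₀∕2} ≤ (κ₀∕2−1)(ε∕4)N^{κ₀∕2−1}`, the profile is `≤ η` from `J` on with `2η·Σ_{n≤N}Λⁿ ≤ ε∕4`, and `w_K ≤ ε∕4`, then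
  `∣genFun Z K t − genFunLim Z t∣ ≤ 2·vol·ε` on `∣t∣ ≤ l₀` for every `K ≥ J + N`.

VERDICT FOR THE ROW (census C44 (c)).  The King route's node U6 is effective in CLOSED FORM: `K(ε) = J(ε∕(8Σ_{n≤N(ε)}Λⁿ)) + N(ε)` with
`N(ε) = max(⌈log((1−a)ε∕(4E₁))∕log a⌉, ⌈(4R₁b₀^{−κ₀∕2}∕((κ₀∕2−1)ε))^{1∕(κ₀∕2−1)}⌉, 1)` in the printed scalars, `J` the profile's modulus and `w_K ≤ ε∕4` the weight-class
input; NOTHING new is owed; CLASSIFICATION OF NE9 UNCHANGED: WORK-bound (W1; instance 0∕1).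

HONEST FRAMING: bookkeeping for rung (B)+1 on ONE FIXED finite four-torus; elementary real analysis (integral test for a p-series, finite sums) on hypothesis SHAPES;
(2.43)∕(2.44) are Bałaban's printed Theorem 2 of [III], displayed as SHAPES and NOT proved here; (0.31) enters as the hypothesis `Step.Discrete031` (cell flag COND-BetaPertH);
King's matching shape is [King1986] Thm 3.4's organisation for d = 3, NOT in print for Bałaban's d = 4 procedure; every `K(ε)` here is a MODEL-level formula, not a
certified constant of Bałaban's; NE9 NOT PRINTED ∕ NOT PROVED; spine PROVED 0∕9 unchanged; NOT UV stability, NOT the continuum limit, NOT infinite volume, NOT a mass gap,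
NOT Clay.  HONEST DEPENDENCY: continuum YM on T⁴ ⇐ BetaPertH ∧ nine spine estimates (0∕9 proved); BetaPertH ⇐ (D1) ∧ (D4) ∧ CAP+tail.

References (TYPES only): [Balaban1988Convergent] = T. Bałaban, Commun. Math. Phys. **119** (1988) 243–285, Thm 2 (2.43)–(2.44) p. 263; [Balaban1987RG1] =
T. Bałaban, Commun. Math. Phys. **109** (1987) 249–301, (0.31) p. 259; [King1986] = C. King, Commun. Math. Phys. **102** (1986) 649–677, Thm 3.4 p. 656, p. 657.
-/

namespace Summit.QuantumFields.BalabanUV.T4Continuum.NE9.DirectPairingEffectiveU6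

open scoped BigOperators
open Finset Filter Topology
open Literature.MathematicalPhysics.QuantumFieldTheory.Balaban1983to89
open T4CauchySum (genFun genFunLim)
open Summit.QuantumFields.BalabanUV.T4Continuum.NE9.DirectPairingCrossoverEffective (abs_genFun_sub_lim_le_window)

/-! ## §1 The p-series tail by the integral test -/

/-- **p-SERIES TAIL, PARTIAL SUMS.**  For `s > 1`, `N ≥ 1` and every `M`: `Σ_{i<M} (i+N+1)^{−s} ≤ N^{1−s}∕(s−1)` (each term `≤ ∫_{N+i}^{N+i+1} x^{−s}dx`;
Mathlib's `AntitoneOn.sum_le_integral` and `integral_rpow`). [folklore] -/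
theorem sum_range_rpow_neg_shift_le {s : ℝ} (hs : 1 < s) {N : ℕ} (hN : 1 ≤ N) (M : ℕ) :
    ∑ i ∈ range M, (((i + (N + 1) : ℕ) : ℝ)) ^ (-s) ≤ (N : ℝ) ^ (1 - s) / (s - 1) := by
  have hN0 : (0 : ℝ) < (N : ℝ) := by exact_mod_cast hN
  have hanti : AntitoneOn (fun x : ℝ => x ^ (-s)) (Set.Icc (N : ℝ) ((N : ℝ) + M)) := by
    intro x hx y _ hxy
    exact Real.rpow_le_rpow_of_nonpos (lt_of_lt_of_le hN0 hx.1) hxy (by linarith)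
  have h := AntitoneOn.sum_le_integral hanti
  -- `h : Σ_{i<M} (N + (i+1))^{−s} ≤ ∫_N^{N+M} x^{−s} dx`
  have hsum : ∑ i ∈ range M, (((i + (N + 1) : ℕ) : ℝ)) ^ (-s) = ∑ i ∈ range M, ((N : ℝ) + ((i + 1 : ℕ) : ℝ)) ^ (-s) :=
    sum_congr rfl fun i _ => by push_cast; ring_nf
  rw [hsum]
  refine h.trans ?_
  have h0 : (0 : ℝ) ∉ Set.uIcc (N : ℝ) ((N : ℝ) + M) :=
    Set.notMem_uIcc_of_lt hN0 (by positivity)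
  rw [integral_rpow (Or.inr ⟨by linarith, h0⟩)]
  have hs1 : -s + 1 = -(s - 1) := by ring
  have hB : 0 ≤ ((N : ℝ) + M) ^ (-s + 1) := Real.rpow_nonneg (by positivity) _
  have hsm1 : 0 < s - 1 := by linarith
  -- direct algebra: (B − A)/(−(s−1)) = (A − B)/(s−1) ≤ A/(s−1)
  have key : (((N : ℝ) + M) ^ (-s + 1) - (N : ℝ) ^ (-s + 1)) / (-s + 1)
      = ((N : ℝ) ^ (1 - s) - ((N : ℝ) + M) ^ (-s + 1)) / (s - 1) := by
    have e : -(s - 1) = 1 - s := by ring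
    rw [hs1, div_neg, ← neg_div, neg_sub, e]
  rw [key]
  exact div_le_div_of_nonneg_right (by linarith) hsm1.le

/-- **p-SERIES TAIL.**  For `s > 1`, `N ≥ 1`: `Σ_{i≥0} (i+N+1)^{−s} ≤ N^{1−s}∕(s−1)` (`Real.tsum_le_of_sum_range_le`). [folklore] -/
theorem tsum_rpow_neg_shift_le {s : ℝ} (hs : 1 < s) {N : ℕ} (hN : 1 ≤ N) :
    ∑' i : ℕ, (((i + (N + 1) : ℕ) : ℝ)) ^ (-s) ≤ (N : ℝ) ^ (1 - s) / (s - 1) :=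
  Real.tsum_le_of_sum_range_le (fun i => Real.rpow_nonneg (by positivity) _) fun M => sum_range_rpow_neg_shift_le hs hN M

/-! ## §2 The R-branch tail in closed form -/

/-- **THE R-BRANCH TAIL IN THE PRINTED SCALARS.**  `b₀ > 0`, `R₁ ≥ 0`, `κ₀ > 2`, `N ≥ 1`:
`Σ_{i≥0} R₁(b₀(i+N+1))^{−κ₀∕2} ≤ R₁·b₀^{−κ₀∕2}·N^{1−κ₀∕2}∕(κ₀∕2 − 1)` — the R-slot of `DirectPairingCrossoverEffective.abs_genFun_sub_lim_le_window` ∕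
`crossoverR_le_window` (and `DirectPairingUVTail.uvTailR_le`'s majorant with `K ↦ N`) in closed form. [cite: Balaban1988Convergent, Thm 2 (2.44) p.263] [folklore] -/
theorem crossoverR_tail_le {b₀ R₁ : ℝ} {κ₀ N : ℕ} (hb₀ : 0 < b₀) (hR₁ : 0 ≤ R₁) (hκ : 2 < κ₀) (hN : 1 ≤ N) :
    ∑' i : ℕ, R₁ * (b₀ * (((i + (N + 1) : ℕ) : ℝ)))⁻¹ ^ ((κ₀ : ℝ) / 2)
      ≤ R₁ * b₀ ^ (-((κ₀ : ℝ) / 2)) * ((N : ℝ) ^ (1 - (κ₀ : ℝ) / 2) / ((κ₀ : ℝ) / 2 - 1)) := by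
  set s : ℝ := (κ₀ : ℝ) / 2 with hs
  have hs1 : 1 < s := by
    have h2 : (2 : ℝ) < κ₀ := by exact_mod_cast hκ
    rw [hs]; linarith
  have hterm : ∀ i : ℕ, R₁ * (b₀ * (((i + (N + 1) : ℕ) : ℝ)))⁻¹ ^ s = R₁ * b₀ ^ (-s) * ((((i + (N + 1) : ℕ) : ℝ)) ^ (-s)) := by
    intro i
    have hx : (0 : ℝ) ≤ (((i + (N + 1) : ℕ) : ℝ)) := by positivity
    rw [Real.inv_rpow (mul_nonneg hb₀.le hx), Real.mul_rpow hb₀.le hx, Real.rpow_neg hb₀.le, Real.rpow_neg hx, mul_inv]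
    ring
  simp_rw [hterm]
  rw [tsum_mul_left]
  exact mul_le_mul_of_nonneg_left (tsum_rpow_neg_shift_le hs1 hN) (mul_nonneg hR₁ (Real.rpow_nonneg hb₀.le _))

/-- **CHOOSING THE R-CUT.**  If `R₁·b₀^{−κ₀∕2} ≤ (κ₀∕2 − 1)·δ·N^{κ₀∕2 − 1}` (`N ≥ 1`), the R-branch tail is `≤ δ` — e.g.
`N ≥ (R₁b₀^{−κ₀∕2}∕((κ₀∕2−1)δ))^{1∕(κ₀∕2−1)}`. [folklore] -/
theorem crossoverR_tail_le_of_pow {b₀ R₁ δ : ℝ} {κ₀ N : ℕ} (hb₀ : 0 < b₀) (hR₁ : 0 ≤ R₁) (hκ : 2 < κ₀) (hN : 1 ≤ N)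
    (hcut : R₁ * b₀ ^ (-((κ₀ : ℝ) / 2)) ≤ ((κ₀ : ℝ) / 2 - 1) * δ * (N : ℝ) ^ ((κ₀ : ℝ) / 2 - 1)) :
    ∑' i : ℕ, R₁ * (b₀ * (((i + (N + 1) : ℕ) : ℝ)))⁻¹ ^ ((κ₀ : ℝ) / 2) ≤ δ := by
  refine (crossoverR_tail_le hb₀ hR₁ hκ hN).trans ?_
  set s : ℝ := (κ₀ : ℝ) / 2 with hs
  have hs1 : 1 < s := by
    have h2 : (2 : ℝ) < κ₀ := by exact_mod_cast hκ
    rw [hs]; linarith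
  have hN0 : (0 : ℝ) < (N : ℝ) := by exact_mod_cast hN
  have hNp : 0 < (N : ℝ) ^ (s - 1) := Real.rpow_pos_of_pos hN0 _
  -- `N^{1−s} = (N^{s−1})⁻¹`
  have hinv : (N : ℝ) ^ (1 - s) = ((N : ℝ) ^ (s - 1))⁻¹ := by
    rw [← Real.rpow_neg hN0.le]; congr 1; ring
  rw [hinv, div_eq_mul_inv]
  -- goal: R₁ b₀^{−s} · ((N^{s−1})⁻¹ · (s−1)⁻¹) ≤ δ
  have hpos : 0 < (s - 1) * (N : ℝ) ^ (s - 1) := mul_pos (by linarith) hNp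
  rw [show R₁ * b₀ ^ (-s) * (((N : ℝ) ^ (s - 1))⁻¹ * (s - 1)⁻¹) = R₁ * b₀ ^ (-s) / ((s - 1) * (N : ℝ) ^ (s - 1)) by
    field_simp]
  rw [div_le_iff₀ hpos]
  calc R₁ * b₀ ^ (-s) ≤ (s - 1) * δ * (N : ℝ) ^ (s - 1) := hcut
    _ = δ * ((s - 1) * (N : ℝ) ^ (s - 1)) := by ring

/-! ## §3 Node U6 with all four slots `≤ ε∕4` -/

/-- **THE NODE-U6 `K(ε)` ON THE KING ROUTE.**  Under the hypotheses of `DirectPairingCrossoverEffective.abs_genFun_sub_lim_le_window` (King's matching shape with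
the crossover majorant, `vol ≥ 0`): if a cut `N ≥ 1` passes the two PRINTED-SCALAR tests `E₁a^{N+1}∕(1−a) ≤ ε∕4` (e.g. `…Effective.geomTail_le_of_log`) and
`R₁b₀^{−κ₀∕2} ≤ (κ₀∕2−1)(ε∕4)N^{κ₀∕2−1}` (§2), the profile is `≤ η` (`η ≥ 0`) from the IR scale `J` on with `2η·Σ_{n≤N}Λⁿ ≤ ε∕4` (the E-side's one non-printed
datum: its modulus), and the weight-class term has `w_K ≤ ε∕4`, then for every `K ≥ J + N`: `∣genFun Z K t − genFunLim Z t∣ ≤ 2·vol·ε` on `∣t∣ ≤ l₀`.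
CONDITIONAL kernel theorem; no hypothesis is in print for Bałaban's d = 4 procedure. [cite: King1986, p.657] [folklore] -/
theorem abs_genFun_sub_lim_le_of_scales {E₁ a Λ b₀ β' R₁ vol l₀ η ε : ℝ} {κ₀ : ℕ} {g : ℕ → ℝ} {gs : ℕ → ℕ → ℝ}
    {b w : ℕ → ℝ} {Z : ℕ → ℝ → ℝ} (hE₁ : 0 ≤ E₁) (ha0 : 0 ≤ a) (ha1 : a < 1) (hΛ : 0 ≤ Λ)
    (hb₀ : 0 < b₀) (h031 : ∀ K, Step.Discrete031 b₀ β' K (g K) (gs K)) (hpos : ∀ K k, k ≤ K → 0 ≤ gs K k)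
    (hR₁ : 0 ≤ R₁) (hκ : 2 < κ₀) (hb0 : ∀ j, 0 ≤ b j) (hb : Tendsto b atTop (𝓝 0)) (hw : Tendsto w atTop (𝓝 0))
    (hl₀ : 0 ≤ l₀) (hvol : 0 ≤ vol)
    (hU5 : ∀ K n : ℕ, ∃ c : ℝ, ∀ t : ℝ, |t| ≤ l₀ →
      |Real.log (Z (K + n) t) - Real.log (Z K t) - c| ≤
        vol * ((∑ p ∈ antidiagonal K, min (E₁ * a ^ p.2) (b p.1 * Λ ^ p.2))
          + (∑ p ∈ antidiagonal K, min (R₁ * gs K p.1 ^ κ₀) (b p.1 * Λ ^ p.2)) + w K))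
    {K N J : ℕ} (hN : 1 ≤ N) (hNE : E₁ * a ^ (N + 1) / (1 - a) ≤ ε / 4)
    (hNR : R₁ * b₀ ^ (-((κ₀ : ℝ) / 2)) ≤ ((κ₀ : ℝ) / 2 - 1) * (ε / 4) * (N : ℝ) ^ ((κ₀ : ℝ) / 2 - 1))
    (hη0 : 0 ≤ η) (hJ : ∀ j, J ≤ j → b j ≤ η) (hη : 2 * η * ∑ n ∈ range (N + 1), Λ ^ n ≤ ε / 4)
    (hwK : w K ≤ ε / 4) (hK : J + N ≤ K) {t : ℝ} (ht : |t| ≤ l₀) :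
    |genFun Z K t - genFunLim Z t| ≤ 2 * (vol * ε) := by
  have h := abs_genFun_sub_lim_le_window (N := N) (β := η) hE₁ ha0 ha1 hΛ hb₀ h031 hpos hR₁ hκ hb0 hb hw hl₀ hvol hU5
    hη0 (fun j hj _ => hJ j (by omega)) ht (K := K)
  have hR := crossoverR_tail_le_of_pow (δ := ε / 4) hb₀ hR₁ hκ hN hNR
  refine h.trans ?_
  have hsum : E₁ * a ^ (N + 1) / (1 - a)
      + (∑' i : ℕ, R₁ * (b₀ * (((i + (N + 1) : ℕ) : ℝ)))⁻¹ ^ ((κ₀ : ℝ) / 2))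
      + 2 * η * (∑ n ∈ range (N + 1), Λ ^ n) + w K ≤ ε := by
    linarith
  gcongr

end Summit.QuantumFields.BalabanUV.T4Continuum.NE9.DirectPairingEffectiveU6
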